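import Summits.CriticalPhenomena.Ising3DConformalLimit.Theorems.InversionUpgradeNormalised.Negative.SixPointWitness
import Summits.CriticalPhenomena.Ising3DConformalLimit.Theorems.EnergyNotSigmaSquaredMoebiusLimitExistsDefs
import HarnessLib

/-!
# `MoebiusLimitExists` (item stmt-CriticalPhenomena-1344), line `only-interaction-breaks-moebius`:
# MÖBIUS-COVARIANT INTERACTING DECOYS — uniqueness (STUB 6′) is invisible to covariance and to the order-4 inequalities

Negative knowledge for the picked line (refuter `drefute` gen-5; skeleton v3, residues
`stub_interactingInversion_ge_four` (5′) and `stub_interactingUnique_ge_four` (6′)).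

`Negative/StubsNeedLattice.lean` / `Negative/StubsWithoutLattice.lean` show that 5′/6′ are false once
the lattice provenance `IsClusterPoint` is dropped, using families with CONSTANT four-point function —
neither scale nor inversion covariant. This file sharpens the analysis of 6′: the decoys can be taken
inside the full closed class that every engine for 5′ would certify,

  `harmFamily g Δ`:  `S₀ = 1`, `S₂ = ‖x−y‖^{-2Δ}`, `S₄ = Wick − g·harm` on non-coincident
  configurations (`harm = (W₁⁻¹+W₂⁻¹+W₃⁻¹)⁻¹`, the conformally covariant combination of the three Wick
  products of `Negative/SixPointWitness.lean` of crux `InversionUpgradeNormalised`), `0` elsewhere,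

a ONE-PARAMETER family (coupling `g`) of REGULAR (normalised, continuous off the diagonals, translation
invariant), fully MÖBIUS-COVARIANT (translations, `O(3)`, dilations AND the unit inversion, weight `Δ`,
at every order), pairwise distinct families with the SAME pure-power two-point function, interacting
(`U₄ = −g·harm < 0` off the diagonals) for `g ≠ 0`, with the Lebowitz sign `U₄ ≤ 0` for `g ≥ 0` and the
Griffiths-II lower bounds `S₄ ≥ S₂S₂` (each pairing) for `g ≤ 1`.

Consequences (theorems below):
* `interactingUnique_false_without_clusterPoint_moebius`: STUB 6′ with `IsClusterPoint` replaced by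
  {Möbius covariance with the right `Δ` of BOTH families, interaction of BOTH, Lebowitz sign of BOTH}
  is FALSE for every `Δ > 0`. So even a PROOF of 5′ (inversion covariance of every interacting regular
  cluster point) gives nothing towards 6′: modulo every closed pointwise constraint the two open
  covariance residues of the line are independent, and an engine for 6′ (no drift / no coexistence of
  distinct interacting cluster points) must consume the lattice sequence itself — or reflection
  positivity at ALL orders: these decoys are truncated (`S₆ ≡ 0`), hence not OS-positive by
  `InversionUpgradeNormalisedNegative.even_order_ne_zero_of_reflectionPositive`; (paper remark) OS-positive
  Möbius decoys with a common `S₂` exist as well — Gaussian scale mixtures `σ = A·φ` (`φ` the generalised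
  free field of dimension `Δ ≥ 1/2`, `A` an independent random amplitude with `E A² = 1`; convex
  combinations of OS-positive Möbius-covariant laws are OS-positive and Möbius covariant) — but they have
  `U₄ = (E A⁴ − 1)·Wick ≥ 0`, so uniqueness could at best follow from {OS positivity at all orders + Möbius +
  Lebowitz sign}, for which no theorem exists either.
* `exists_moebius_interacting_decoy`: the conjunct's clause shape {non-degenerate, Möbius covariant with
  `Δ`, `HasNontrivialU4`, Lebowitz, Griffiths II at order 4} is inhabited by explicit elementary families
  for EVERY `Δ > 0` — all CFT-data content of the summit lies in the lattice limit (and OS positivity),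
  none in this clause list.

References: Di Francesco–Mathieu–Sénéchal 1997 §4.3.1 (covariance of `n`-point functions); Lebowitz,
Comm. Math. Phys. 35 (1974) 87 (`U₄ ≤ 0`); Griffiths–Kelly–Sherman (second Griffiths inequality).
-/

noncomputable section

namespace Summit.CriticalPhenomena.Ising3DConformalLimit.MoebiusDecoys

open Literature.Probability.LatticeModels Literature.Barriers.CriticalPhenomena
open Set Function EuclideanGeometry ScaleNotMoebius
open Summit.CriticalPhenomena.Ising3DConformalLimit.InversionUpgradeNormalisedNegative
open Summit.CriticalPhenomena.Ising3DConformalLimit.MoebiusLimitExistsOnlyInteraction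

/-! ## The decoy family -/

open Classical in
/-- The Möbius decoy with coupling `g` and dimension `Δ`: `S₀ = 1`, `S₂ = ‖x₀−x₁‖^{-2Δ}`,
`S₄ = Wick − g·harm` on non-coincident configurations, `0` on coincident ones and at all other orders. [folklore] -/
def harmFamily (g Δ : ℝ) : CorrFamily 3 := fun n =>
  match n with
  | 0 => fun _ => 1
  | 2 => fun x => twoPt Δ (x 0) (x 1)
  | 4 => fun x => if Function.Injective x then wick Δ x - g * harm Δ x else 0
  | _ => fun _ => 0

/-- Unfolding, `n = 0`. [folklore] -/
theorem harmFamily_zero (g Δ : ℝ) (x : Fin 0 → EuclideanSpace ℝ (Fin 3)) : harmFamily g Δ 0 x = 1 := rfl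

/-- Unfolding, `n = 2`. [folklore] -/
theorem harmFamily_two (g Δ : ℝ) (x : Fin 2 → EuclideanSpace ℝ (Fin 3)) :
    harmFamily g Δ 2 x = twoPt Δ (x 0) (x 1) := rfl

open Classical in
/-- Unfolding, `n = 4`. [folklore] -/
theorem harmFamily_four (g Δ : ℝ) (x : Fin 4 → EuclideanSpace ℝ (Fin 3)) :
    harmFamily g Δ 4 x = if Function.Injective x then wick Δ x - g * harm Δ x else 0 := rfl

/-- Unfolding, `n = 4`, non-coincident configuration. [folklore] -/
theorem harmFamily_four_of_injective (g Δ : ℝ) {x : Fin 4 → EuclideanSpace ℝ (Fin 3)}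
    (hx : Function.Injective x) : harmFamily g Δ 4 x = wick Δ x - g * harm Δ x := by
  rw [harmFamily_four, if_pos hx]

/-- Unfolding, `n = 4`, coincident configuration. [folklore] -/
theorem harmFamily_four_of_not_injective (g Δ : ℝ) {x : Fin 4 → EuclideanSpace ℝ (Fin 3)}
    (hx : ¬ Function.Injective x) : harmFamily g Δ 4 x = 0 := by
  rw [harmFamily_four, if_neg hx]

/-- All orders other than `0, 2, 4` vanish identically. [folklore] -/
theorem harmFamily_eq_zero_of_ne (g Δ : ℝ) {n : ℕ} (h0 : n ≠ 0) (h2 : n ≠ 2) (h4 : n ≠ 4)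
    (x : Fin n → EuclideanSpace ℝ (Fin 3)) : harmFamily g Δ n x = 0 := by
  match n, x, h0, h2, h4 with
  | 0, _, h0, _, _ => exact absurd rfl h0
  | 1, _, _, _, _ => rfl
  | 2, _, _, h2, _ => exact absurd rfl h2
  | 3, _, _, _, _ => rfl
  | 4, _, _, _, h4 => exact absurd rfl h4
  | (n + 5), _, _, _, _ => rfl

/-- The pure-power two-point law, verbatim as in the stubs of the line. [folklore] -/
theorem harmFamily_twoPoint (g Δ : ℝ) :
    ∀ x ∈ NonCoincident 3 2, harmFamily g Δ 2 x = ‖x 0 - x 1‖ ^ (-(2 * Δ)) := fun _ _ => rfl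

/-! ## Regularity -/

/-- Normalisation: the decoy vanishes off `NonCoincident` (`Δ ≠ 0`). [folklore] -/
theorem isNormalised_harmFamily (g : ℝ) {Δ : ℝ} (hΔ : Δ ≠ 0) : IsNormalised (harmFamily g Δ) := by
  intro n x hx
  rw [mem_nonCoincident] at hx
  match n, x, hx with
  | 0, x, hx => exact absurd (Function.injective_of_subsingleton x) hx
  | 1, _, _ => rfl
  | 2, x, hx =>
    rw [harmFamily_two]
    have h01 : x 0 = x 1 := by
      by_contra h
      exact hx ((injective_fin_two_iff x).2 h)
    rw [h01]
    exact twoPt_self hΔ _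
  | 3, _, _ => rfl
  | 4, x, hx => rw [harmFamily_four, if_neg hx]
  | (n + 5), _, _ => rfl

/-- `harm` is continuous on the non-coincident four-point configurations. [folklore] -/
theorem continuousOn_harm (Δ : ℝ) : ContinuousOn (harm Δ) (NonCoincident 3 4) := by
  have hinj : ∀ x ∈ NonCoincident 3 4, Function.Injective x := fun x hx => (mem_nonCoincident x).1 hx
  have htp : ∀ i j : Fin 4, i ≠ j →
      ContinuousOn (fun x : Fin 4 → (EuclideanSpace ℝ (Fin 3)) => twoPt Δ (x i) (x j)) (NonCoincident 3 4) :=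
    fun i j hij => (continuousOn_twoPt Δ i j).mono fun x hx h => hij (hinj x hx h)
  have hW1 : ContinuousOn (W1 Δ) (NonCoincident 3 4) := (htp 0 1 (by decide)).mul (htp 2 3 (by decide))
  have hW2 : ContinuousOn (W2 Δ) (NonCoincident 3 4) := (htp 0 2 (by decide)).mul (htp 1 3 (by decide))
  have hW3 : ContinuousOn (W3 Δ) (NonCoincident 3 4) := (htp 0 3 (by decide)).mul (htp 1 2 (by decide))
  unfold harm
  refine ContinuousOn.inv₀ ?_ fun x hx => ?_
  · exact ((hW1.inv₀ fun x hx => (W1_pos Δ (hinj x hx)).ne').add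
      (hW2.inv₀ fun x hx => (W2_pos Δ (hinj x hx)).ne')).add
      (hW3.inv₀ fun x hx => (W3_pos Δ (hinj x hx)).ne')
  · have h1 := W1_pos Δ (hinj x hx); have h2 := W2_pos Δ (hinj x hx); have h3 := W3_pos Δ (hinj x hx)
    positivity

/-- `wick` is continuous on the non-coincident four-point configurations. [folklore] -/
theorem continuousOn_wick (Δ : ℝ) : ContinuousOn (wick Δ) (NonCoincident 3 4) := by
  have hinj : ∀ x ∈ NonCoincident 3 4, Function.Injective x := fun x hx => (mem_nonCoincident x).1 hx
  have htp : ∀ i j : Fin 4, i ≠ j →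
      ContinuousOn (fun x : Fin 4 → (EuclideanSpace ℝ (Fin 3)) => twoPt Δ (x i) (x j)) (NonCoincident 3 4) :=
    fun i j hij => (continuousOn_twoPt Δ i j).mono fun x hx h => hij (hinj x hx h)
  unfold wick
  exact (((htp 0 1 (by decide)).mul (htp 2 3 (by decide))).add
    ((htp 0 2 (by decide)).mul (htp 1 3 (by decide)))).add
    ((htp 0 3 (by decide)).mul (htp 1 2 (by decide)))

/-- The decoy is continuous off the diagonals, in every arity. [folklore] -/
theorem continuousOn_harmFamily (g Δ : ℝ) (n : ℕ) :
    ContinuousOn (harmFamily g Δ n) (NonCoincident 3 n) := by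
  match n with
  | 0 => exact continuousOn_const
  | 1 => exact continuousOn_const
  | 2 =>
    refine ((continuousOn_twoPt Δ (0 : Fin 2) 1).mono fun x hx => ?_).congr
      fun x _ => harmFamily_two g Δ x
    exact (injective_fin_two_iff x).1 ((mem_nonCoincident x).1 hx)
  | 3 => exact continuousOn_const
  | 4 =>
    have hinj : ∀ x ∈ NonCoincident 3 4, Function.Injective x := fun x hx => (mem_nonCoincident x).1 hx
    have heq : Set.EqOn (harmFamily g Δ 4) (fun x => wick Δ x - g * harm Δ x) (NonCoincident 3 4) :=
      fun x hx => harmFamily_four_of_injective g Δ (hinj x hx)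
    refine ContinuousOn.congr ?_ heq
    exact (continuousOn_wick Δ).sub (continuousOn_const.mul (continuousOn_harm Δ))
  | (n + 5) => exact continuousOn_const

/-- Translation invariance. [folklore] -/
theorem isTranslationInvariant_harmFamily (g Δ : ℝ) : IsTranslationInvariant (harmFamily g Δ) := by
  intro n v x
  match n, x with
  | 0, _ => rfl
  | 1, _ => rfl
  | 2, x => simp [harmFamily_two, twoPt_add]
  | 3, _ => rfl
  | 4, x =>
    simp only [harmFamily_four, injective_comp_iff (add_left_injective v) x, wick, twoPt_add, harm_add]
  | (n + 5), _ => rfl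

/-- `O(3)` invariance. [folklore] -/
theorem isRotationInvariant_harmFamily (g Δ : ℝ) : IsRotationInvariant (harmFamily g Δ) := by
  intro n R x
  match n, x with
  | 0, _ => rfl
  | 1, _ => rfl
  | 2, x => simp [harmFamily_two, twoPt_map]
  | 3, _ => rfl
  | 4, x =>
    simp only [harmFamily_four, injective_comp_iff R.injective x, wick, twoPt_map, harm_map]
  | (n + 5), _ => rfl

/-- Scale covariance with dimension `Δ`. [folklore] -/
theorem isScaleCovariant_harmFamily (g Δ : ℝ) : IsScaleCovariant Δ (harmFamily g Δ) := by
  intro n c hc x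
  match n, x with
  | 0, _ => simp [harmFamily]
  | 1, _ => simp [harmFamily]
  | 2, x =>
    have h1 : (-((2 : ℕ) : ℝ) * Δ) = -(2 * Δ) := by push_cast; ring
    rw [harmFamily_two, harmFamily_two, h1]
    exact twoPt_smul Δ hc _ _
  | 3, _ => simp [harmFamily]
  | 4, x =>
    have hinj := injective_comp_iff (smul_right_injective _ hc.ne') x
    by_cases hx : Function.Injective x
    · rw [harmFamily_four, harmFamily_four, if_pos (hinj.2 hx), if_pos hx, wick_smul Δ hc,
        harm_smul Δ hc hx]
      have h1 : (-((4 : ℕ) : ℝ) * Δ) = -(2 * Δ) + -(2 * Δ) := by push_cast; ring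
      rw [h1, Real.rpow_add hc]
      ring
    · rw [harmFamily_four, harmFamily_four, if_neg (mt hinj.1 hx), if_neg hx, mul_zero]
  | (n + 5), _ => simp [harmFamily]

/-- Inversion covariance with dimension `Δ`, at EVERY order (the point of the decoy). [folklore] -/
theorem isInversionCovariant_harmFamily (g Δ : ℝ) : IsInversionCovariant Δ (harmFamily g Δ) := by
  intro n x hx0
  match n, x, hx0 with
  | 0, _, _ => simp [harmFamily]
  | 1, _, _ => simp [harmFamily]
  | 2, x, hx0 =>
    rw [harmFamily_two, harmFamily_two, twoPt_inversion Δ (hx0 0) (hx0 1), Fin.prod_univ_two]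
  | 3, _, _ => simp [harmFamily]
  | 4, x, hx0 =>
    have hinj := injective_comp_iff (inversion_injective (0 : EuclideanSpace ℝ (Fin 3)) one_ne_zero) x
    by_cases hx : Function.Injective x
    · rw [harmFamily_four, harmFamily_four, if_pos (hinj.2 hx), if_pos hx, wick_inversion Δ hx0,
        harm_inversion Δ hx0 hx]
      ring
    · rw [harmFamily_four, harmFamily_four, if_neg (mt hinj.1 hx), if_neg hx, mul_zero]
  | (n + 5), _, _ => simp [harmFamily]

/-- **The decoy is Möbius covariant with dimension `Δ`.** [folklore] -/
theorem isMoebiusCovariant_harmFamily (g Δ : ℝ) : IsMoebiusCovariant Δ (harmFamily g Δ) :=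
  ⟨⟨isTranslationInvariant_harmFamily g Δ, isRotationInvariant_harmFamily g Δ⟩,
    isScaleCovariant_harmFamily g Δ, isInversionCovariant_harmFamily g Δ⟩

/-- **The decoy is REGULAR** in the sense of the line (`Δ ≠ 0`). [folklore] -/
theorem isRegular_harmFamily (g : ℝ) {Δ : ℝ} (hΔ : Δ ≠ 0) :
    MoebiusLimitExistsOnlyInteraction.IsRegular (harmFamily g Δ) :=
  ⟨isNormalised_harmFamily g hΔ, continuousOn_harmFamily g Δ, isTranslationInvariant_harmFamily g Δ⟩

/-- Non-degenerate two-point function. [folklore] -/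
theorem isNondegenerateTwoPoint_harmFamily (g Δ : ℝ) : IsNondegenerateTwoPoint (harmFamily g Δ) := by
  intro x hx
  rw [harmFamily_two]
  exact twoPt_pos Δ ((mem_nonCoincident x |>.1 hx).ne (by decide))

/-! ## The connected four-point function: interaction, Lebowitz sign, Griffiths II -/

/-- `U₄ = −g·harm` on non-coincident configurations. [folklore] -/
theorem limitConnectedFour_harmFamily (g Δ : ℝ) {x : Fin 4 → EuclideanSpace ℝ (Fin 3)}
    (hx : Function.Injective x) : limitConnectedFour (harmFamily g Δ) x = -(g * harm Δ x) := by
  simp only [limitConnectedFour, harmFamily_four, if_pos hx, harmFamily_two, wick,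
    Matrix.cons_val_zero, Matrix.cons_val_one]
  ring

/-- `U₄ = −Wick` on coincident configurations (normalisation). [folklore] -/
theorem limitConnectedFour_harmFamily_of_not_injective (g Δ : ℝ)
    {x : Fin 4 → EuclideanSpace ℝ (Fin 3)} (hx : ¬ Function.Injective x) :
    limitConnectedFour (harmFamily g Δ) x = -wick Δ x := by
  simp only [limitConnectedFour, harmFamily_four, if_neg hx, harmFamily_two, wick,
    Matrix.cons_val_zero, Matrix.cons_val_one]
  ring

/-- **Lebowitz sign**: `U₄ ≤ 0` everywhere, for `g ≥ 0`. [folklore] -/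
theorem limitConnectedFour_harmFamily_nonpos {g : ℝ} (hg : 0 ≤ g) (Δ : ℝ)
    (x : Fin 4 → EuclideanSpace ℝ (Fin 3)) : limitConnectedFour (harmFamily g Δ) x ≤ 0 := by
  by_cases hx : Function.Injective x
  · rw [limitConnectedFour_harmFamily g Δ hx, neg_nonpos]
    exact mul_nonneg hg (harm_pos Δ hx).le
  · rw [limitConnectedFour_harmFamily_of_not_injective g Δ hx, neg_nonpos]
    exact wick_nonneg Δ x

/-- **Interaction**: `U₄ ≢ 0` for `g ≠ 0` (indeed `U₄ = −g·harm ≠ 0` off the diagonals). [folklore] -/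
theorem hasNontrivialU4_harmFamily {g : ℝ} (hg : g ≠ 0) (Δ : ℝ) : HasNontrivialU4 (harmFamily g Δ) :=
  ⟨configInv, (mem_nonCoincident _).2 configInv_injective, by
    rw [limitConnectedFour_harmFamily g Δ configInv_injective, neg_ne_zero]
    exact mul_ne_zero hg (harm_pos Δ configInv_injective).ne'⟩

/-- **Griffiths II at order 4**: for `g ≤ 1` every Wick pairing product is a lower bound of `S₄`
(`harm ≤ W_p` for each `p`). [folklore] -/
theorem harmFamily_griffithsII {g : ℝ} (hg1 : g ≤ 1) (Δ : ℝ)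
    {x : Fin 4 → EuclideanSpace ℝ (Fin 3)} (hx : Function.Injective x) :
    harmFamily g Δ 2 ![x 0, x 1] * harmFamily g Δ 2 ![x 2, x 3] ≤ harmFamily g Δ 4 x ∧
    harmFamily g Δ 2 ![x 0, x 2] * harmFamily g Δ 2 ![x 1, x 3] ≤ harmFamily g Δ 4 x ∧
    harmFamily g Δ 2 ![x 0, x 3] * harmFamily g Δ 2 ![x 1, x 2] ≤ harmFamily g Δ 4 x := by
  have h1 := W1_pos Δ hx; have h2 := W2_pos Δ hx; have h3 := W3_pos Δ hx
  have hh := harm_pos Δ hx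
  have hle1 := harm_le_W1 Δ hx; have hle2 := harm_le_W2 Δ hx; have hle3 := harm_le_W3 Δ hx
  have hgh : g * harm Δ x ≤ harm Δ x := by nlinarith
  simp only [harmFamily_two, harmFamily_four_of_injective g Δ hx, wick_eq, Matrix.cons_val_zero,
    Matrix.cons_val_one]
  refine ⟨?_, ?_, ?_⟩
  · change W1 Δ x ≤ W1 Δ x + W2 Δ x + W3 Δ x - g * harm Δ x
    linarith
  · change W2 Δ x ≤ W1 Δ x + W2 Δ x + W3 Δ x - g * harm Δ x
    linarith
  · change W3 Δ x ≤ W1 Δ x + W2 Δ x + W3 Δ x - g * harm Δ x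
    linarith

/-- `S₄ > 0` off the diagonals for `g ≤ 1`. [folklore] -/
theorem harmFamily_four_pos {g : ℝ} (hg1 : g ≤ 1) (Δ : ℝ)
    {x : Fin 4 → EuclideanSpace ℝ (Fin 3)} (hx : Function.Injective x) : 0 < harmFamily g Δ 4 x := by
  have h := (harmFamily_griffithsII hg1 Δ hx).1
  have h01 : 0 < harmFamily g Δ 2 ![x 0, x 1] := by
    rw [harmFamily_two]
    exact twoPt_pos Δ (hx.ne (show (0 : Fin 4) ≠ 1 by decide))
  have h23 : 0 < harmFamily g Δ 2 ![x 2, x 3] := by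
    rw [harmFamily_two]
    exact twoPt_pos Δ (hx.ne (show (2 : Fin 4) ≠ 3 by decide))
  exact lt_of_lt_of_le (mul_pos h01 h23) h

/-- Distinct couplings give distinct four-point functions at `(e₀, 2e₀, 3e₀, 4e₀)`. [folklore] -/
theorem harmFamily_four_ne {g g' : ℝ} (hg : g ≠ g') (Δ : ℝ) :
    harmFamily g Δ 4 configInv ≠ harmFamily g' Δ 4 configInv := by
  rw [harmFamily_four_of_injective g Δ configInv_injective,
    harmFamily_four_of_injective g' Δ configInv_injective]
  intro h
  have hh := harm_pos Δ configInv_injective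
  have : g * harm Δ configInv = g' * harm Δ configInv := by linarith
  exact hg (mul_right_cancel₀ hh.ne' this)

/-! ## Consequences for the line -/

/-- **STUB 6′ is false without the lattice provenance EVEN INSIDE THE MÖBIUS-COVARIANT, LEBOWITZ-SIGNED,
INTERACTING class** (every `Δ > 0`): replacing `IsClusterPoint S₁, IsClusterPoint S₂` by Möbius
covariance of both families with the right weight `Δ`, interaction of both and the Lebowitz sign of both
does not rescue uniqueness at order 4 — witnesses `harmFamily 1 Δ`, `harmFamily (1/2) Δ`. In particular a
proof of STUB 5′ (inversion covariance of interacting regular cluster points) contributes nothing to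
STUB 6′. [folklore] -/
theorem interactingUnique_false_without_clusterPoint_moebius {Δ : ℝ} (hΔ : 0 < Δ) :
    ¬ ∀ (S₁ S₂ : CorrFamily 3),
        MoebiusLimitExistsOnlyInteraction.IsRegular S₁ → MoebiusLimitExistsOnlyInteraction.IsRegular S₂ →
        IsMoebiusCovariant Δ S₁ → IsMoebiusCovariant Δ S₂ →
        (∀ x ∈ NonCoincident 3 2, S₁ 2 x = ‖x 0 - x 1‖ ^ (-(2 * Δ))) →
        (∀ x ∈ NonCoincident 3 2, S₂ 2 x = ‖x 0 - x 1‖ ^ (-(2 * Δ))) →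
        HasNontrivialU4 S₁ → HasNontrivialU4 S₂ →
        (∀ x, limitConnectedFour S₁ x ≤ 0) → (∀ x, limitConnectedFour S₂ x ≤ 0) →
        ∀ m : ℕ, 2 ≤ m → (NonCoincident 3 (2 * m)).EqOn (S₁ (2 * m)) (S₂ (2 * m)) := by
  intro h
  have hhalf : (1 / 2 : ℝ) ≠ 0 := by norm_num
  have key := h (harmFamily 1 Δ) (harmFamily (1 / 2) Δ)
    (isRegular_harmFamily 1 hΔ.ne') (isRegular_harmFamily (1 / 2) hΔ.ne')
    (isMoebiusCovariant_harmFamily 1 Δ) (isMoebiusCovariant_harmFamily (1 / 2) Δ)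
    (harmFamily_twoPoint 1 Δ) (harmFamily_twoPoint (1 / 2) Δ)
    (hasNontrivialU4_harmFamily one_ne_zero Δ) (hasNontrivialU4_harmFamily hhalf Δ)
    (limitConnectedFour_harmFamily_nonpos zero_le_one Δ)
    (limitConnectedFour_harmFamily_nonpos (by norm_num) Δ) 2 le_rfl
    ((mem_nonCoincident _).2 configInv_injective)
  exact harmFamily_four_ne (show (1 : ℝ) ≠ 1 / 2 by norm_num) Δ key

/-- **An explicit pair of Möbius-covariant interacting decoys with a common two-point function**, for
every `Δ > 0`: regular, Möbius covariant with weight `Δ`, pure-power `S₂`, `U₄ ≤ 0` and `U₄ ≢ 0`,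
Griffiths II at order 4 — and different at order 4. [folklore] -/
theorem exists_moebius_interacting_decoy_pair {Δ : ℝ} (hΔ : 0 < Δ) :
    ∃ S₁ S₂ : CorrFamily 3,
      MoebiusLimitExistsOnlyInteraction.IsRegular S₁ ∧ MoebiusLimitExistsOnlyInteraction.IsRegular S₂ ∧
      IsMoebiusCovariant Δ S₁ ∧ IsMoebiusCovariant Δ S₂ ∧
      (∀ x ∈ NonCoincident 3 2, S₁ 2 x = ‖x 0 - x 1‖ ^ (-(2 * Δ))) ∧
      (∀ x ∈ NonCoincident 3 2, S₂ 2 x = ‖x 0 - x 1‖ ^ (-(2 * Δ))) ∧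
      HasNontrivialU4 S₁ ∧ HasNontrivialU4 S₂ ∧
      (∀ x, limitConnectedFour S₁ x ≤ 0) ∧ (∀ x, limitConnectedFour S₂ x ≤ 0) ∧
      (∀ x : Fin 4 → EuclideanSpace ℝ (Fin 3), Function.Injective x →
        S₁ 2 ![x 0, x 1] * S₁ 2 ![x 2, x 3] ≤ S₁ 4 x ∧ S₁ 2 ![x 0, x 2] * S₁ 2 ![x 1, x 3] ≤ S₁ 4 x ∧
        S₁ 2 ![x 0, x 3] * S₁ 2 ![x 1, x 2] ≤ S₁ 4 x) ∧
      ∃ x ∈ NonCoincident 3 4, S₁ 4 x ≠ S₂ 4 x :=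
  ⟨harmFamily 1 Δ, harmFamily (1 / 2) Δ, isRegular_harmFamily 1 hΔ.ne', isRegular_harmFamily (1 / 2) hΔ.ne',
    isMoebiusCovariant_harmFamily 1 Δ, isMoebiusCovariant_harmFamily (1 / 2) Δ, harmFamily_twoPoint 1 Δ,
    harmFamily_twoPoint (1 / 2) Δ, hasNontrivialU4_harmFamily one_ne_zero Δ,
    hasNontrivialU4_harmFamily (by norm_num) Δ, limitConnectedFour_harmFamily_nonpos zero_le_one Δ,
    limitConnectedFour_harmFamily_nonpos (by norm_num) Δ,
    fun _ hx => harmFamily_griffithsII le_rfl Δ hx,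
    configInv, (mem_nonCoincident _).2 configInv_injective,
    harmFamily_four_ne (show (1 : ℝ) ≠ 1 / 2 by norm_num) Δ⟩

/-- **The conjunct's clause list minus the lattice is inhabited by elementary decoys**, for every `Δ > 0`:
a regular family with non-degenerate pure-power `S₂`, Möbius covariant with weight `Δ`, interacting with
the Lebowitz sign. (All CFT-data content of the summit sits in the lattice limit and in OS positivity at
all orders, none in these clauses.) [folklore] -/
theorem exists_moebius_interacting_decoy {Δ : ℝ} (hΔ : 0 < Δ) :
    ∃ S : CorrFamily 3, MoebiusLimitExistsOnlyInteraction.IsRegular S ∧ IsNondegenerateTwoPoint S ∧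
      IsMoebiusCovariant Δ S ∧ HasNontrivialU4 S ∧ (∀ x, limitConnectedFour S x ≤ 0) ∧
      ∀ x ∈ NonCoincident 3 2, S 2 x = ‖x 0 - x 1‖ ^ (-(2 * Δ)) :=
  ⟨harmFamily 1 Δ, isRegular_harmFamily 1 hΔ.ne', isNondegenerateTwoPoint_harmFamily 1 Δ,
    isMoebiusCovariant_harmFamily 1 Δ, hasNontrivialU4_harmFamily one_ne_zero Δ,
    limitConnectedFour_harmFamily_nonpos zero_le_one Δ, harmFamily_twoPoint 1 Δ⟩

end Summit.CriticalPhenomena.Ising3DConformalLimit.MoebiusDecoys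

end
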